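import Summits.QuantumFields.YangMills.Theorems.BalabanUVNodesN15KingModelContinuumSymbolSeries

/-!
# BalabanUVNodes ∕ N15 — THE KING-MODEL RUNG (PART Ϡ-c): KING's (4.5) AT `η = 0` ON THE TORUS — THE ALIAS SUM `S_K(q)` OF THE ACTUAL OPERATORS IS THE DIGIT SUM
# OF PART Ϡ-b, `a_K → a_∞ = a(1 − L⁻²)`, AND THE `K → ∞` LIMITS `S_K(q) → S_∞(p′(q))`, `Δ^{(K)}(p′) → Δ^{(∞)}(p′) = (a_∞⁻¹ + S_∞(p′))⁻¹` (the continuum form of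
# the effective Laplacian's symbol) and `Δ^{(K)}(p′)⁻¹ = a_K⁻¹ + S_K → a_∞⁻¹ + S_∞` (the symbol of NE2's unit-layer kernel `(Δ^{(K)})⁻¹`)
# (Track A, DAG node N15 = NE2; FAN-OUT v1.1 §N15 s3 «KING-MODEL RUNG … NE2's analogue DECIDED in the model»)

HONEST FRAMING.  Count-neutral (cell `pub-ymgap`, seat `pub-ymgap-dag-n15-e` g32; `--supports stmt-QuantumFields-27366 --as helper` = K3⁸
`SpineGivenEndpointR13SepCoPHV`).  TEMPLATE LITERATURE: C. King, *The U(1) Higgs model. I. The continuum limit*, Commun. Math. Phys. **102** (1986) 649–677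
[King1986] — KING's OWN `A = 0` MODEL: (2.13) p. 653 (`a_k = a(1 − L⁻²)∕(1 − L^{−2k})`; tree `King1986.aK`), (4.5) p. 670 (`Δ^{(k)}(p′) = (a_k⁻¹ + Σ_l
|u^η_k(p′+l)|²Δ^η(p′+l)⁻¹)⁻¹`; tree `Torus.effSym`∕`Torus.Sfib` for the ACTUAL matrices `effLaplacian` on the unit torus `Ω = Tor M`, `effSym_eq_DeltaEff` =
`CompositionLaw.DeltaEff`), with the torus ↔ momentum dictionary of `King1986/TorusAliasDigits` (seat n18-b: `sum_fib_eq_sum_digitBox`, `u_eq_conj_uWeight`,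
`lapSym_fine_eq_latticeSymbol`).  NOT Bałaban's objects; NOT a node discharge (N15 is booked through n15-a's knit, untouched here); nothing continuum-Yang–Mills ∕
ℝ⁴ ∕ OS ∕ mass-gap ∕ Clay.  0 `sorry`; standard axioms.

THE MATHEMATICS.  For odd `N` the alias fibre of `q ∈ Ω̂` IS King's digit box and the fibre summand of `S(q) = Σ_{p ∈ fib q}|u(p)|²∕σ(p)` at the alias of digit
`j` is `|u^{1∕N}(p′+2πj)|²∕Δ^{1∕N}(p′+2πj)` (`p′ = sOf q ∈ (−π, π]^d`), i.e. `Sfib N M N² m² q = aliasSumN N m² p′` (§1).  Part Ϡ-b's Tannery limit along `N = L^K`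
(`L` odd) then gives `S_K(q) → S_∞(p′)`; `a_K → a_∞ = a(1 − L⁻²)` is elementary ((2.13): `L^{−2K} → 0`); so King's symbol `Δ^{(K)}(p′) = a_K∕(1 + a_KS_K)`
converges to `Δ^{(∞)}(p′) := a_∞∕(1 + a_∞S_∞(p′)) = (a_∞⁻¹ + S_∞(p′))⁻¹` — the `η = 0` form of (4.5), the symbol of the unit-lattice effective Laplacian of the
CONTINUUM massive free field blocked to the unit lattice (the Gaussian fixed-point form) — and the symbol `a_K⁻¹ + S_K(q)` of `(Δ^{(K)})⁻¹` (part Ϛ's Woodbury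
split `(Δ^{(K)})⁻¹ = a_K⁻¹·1 + N^dQB⁻¹Qᵀ`, whose second term has fibre form `S`) converges to `a_∞⁻¹ + S_∞(p′)`.

WHAT THIS FILE PROVES (kernel).  §1 ★★ **`Sfib_eq_aliasSumN`** (odd `N`: King's `S(q)` of the torus operators = part Ϡ-b's digit sum at `p′ = sOf q`), `Sfib_le_unif`
(uniform bound).  §2 `aInf a L = a(1 − L⁻²)`, `aInf_pos`, `aInf_le_aK`, ★ **`tendsto_aK`** (`a_K → a_∞`), `tendsto_inv_aK`.  §3 ★★★ **`tendsto_Sfib_pow`** (`S_{L^K}(q) →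
S_∞(p′(q))`, `L` odd `≥ 3`, `m² > 0`, EVERY unit torus `M` and momentum `q`), ★★ **`tendsto_invSym_pow`** (`a_K⁻¹ + S_K(q) → a_∞⁻¹ + S_∞(p′)`), the continuum
symbol `effSymLim a L m² p′ = a_∞∕(1 + a_∞S_∞(p′))` with `effSymLim_pos`, `effSymLim_eq_inv`, ★★★ **`tendsto_effSym_pow`** (`effSym (L^K) M (a_K) (L^{2K}) m² q →
Δ^{(∞)}(p′(q))`) and ★★★ **`tendsto_DeltaEff_pow`** (KING's (4.5) AT `η = 0`: `DeltaEff a_K L^K m² p′(q) → Δ^{(∞)}(p′(q))`).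

HONEST SCOPE.  King's `A = 0` model; odd `L`; `a, m² > 0`; momenta of an arbitrary unit torus `Ω = Π ℤ∕M_μ` (every `2πv∕M_μ`); the general `p′ ∈ [−π, π]^d`
version of the `DeltaEff` limit would need the `N`-periodic re-indexing of `B4Strip`'s uncentred representatives and is not typed.  Nothing here is about Bałaban's
covariant operators.  N15 untouched; counts unmoved.  Locators: [King1986] (2.13)–(2.14) p.653, (4.2)–(4.5) p.670, Lemma 4.3 (4.18) p.672, (4.20)–(4.22) p.672.
-/

noncomputable section

open Complex Finset Filter Topology

namespace Summit.QuantumFields.YangMills.BalabanUVNodes.N15KingModelRung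

open Literature.MathematicalPhysics.QuantumFieldTheory.Balaban1983to89.B5Prop11Plancherel (Tor fine sOf abs_sOf_le)
open Literature.MathematicalPhysics.QuantumFieldTheory.King1986
open Literature.MathematicalPhysics.QuantumFieldTheory.King1986.Torus

variable {d : ℕ}

/-! ## §1 The alias sum of the torus operators is the digit sum of part Ϡ-b -/

section Dictionary

variable (N : ℕ) [NeZero N] (Mv : Fin d → ℕ) [hMv : ∀ μ, NeZero (Mv μ)]

/-- ★★ **KING's `S(q)` OF THE ACTUAL TORUS OPERATORS IS THE DIGIT SUM** (odd `N`, `c = N²`): `Sfib N M N² m² q = aliasSumN N m² (sOf M q)` — the fibre over `q` is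
the digit box (`sum_fib_eq_sum_digitBox`), `|u(p)| = |u^{1∕N}(p′+2πj)|` (`u_eq_conj_uWeight`), `σ(p) = Δ^{1∕N}(p′+2πj)` (`lapSym_fine_eq_latticeSymbol`).
[cite: King1986, (4.2)–(4.5) p.670] -/
theorem Sfib_eq_aliasSumN (hN : Odd N) (m2 : ℝ) (q : Tor Mv) :
    Sfib N Mv ((N : ℝ) ^ 2) m2 q = aliasSumN N m2 (sOf Mv q) := by
  unfold Sfib aliasSumN
  rw [sum_fib_eq_sum_digitBox N Mv hN]
  refine Finset.sum_congr rfl fun w hw => ?_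
  have hp := aliasMom_mem_fib N Mv q w
  rw [aliasTermAt, u_eq_conj_uWeight N Mv hp, lapSym_fine_eq_latticeSymbol N Mv hp m2, digit_aliasMom N Mv hN q hw, Complex.norm_conj]

/-- `S(q) ≤ (π∕2)^{2d}π^d(1 + 4∕π)^d∕m²` for the torus operators, odd `N`, uniformly in `N`, `M`, `q` (`m² > 0`). [cite: King1986, (4.22) p.672] -/
theorem Sfib_le_unif (hN : Odd N) {m2 : ℝ} (hm : 0 < m2) (q : Tor Mv) :
    Sfib N Mv ((N : ℝ) ^ 2) m2 q ≤ (Real.pi / 2) ^ (2 * d) * Real.pi ^ d / m2 * (1 + 4 / Real.pi) ^ d := by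
  rw [Sfib_eq_aliasSumN N Mv hN m2 q]
  exact aliasSumN_le hN hm (abs_sOf_le Mv q)

end Dictionary

/-! ## §2 King's constants: `a_K → a_∞ = a(1 − L⁻²)` -/

section Constants

/-- KING's `a_∞ = lim_k a_k = a(1 − L⁻²)` ((2.13): `a_k = a(1 − L⁻²)∕(1 − L^{−2k})`). [cite: King1986, (2.13) p.653] -/
def aInf (a L : ℝ) : ℝ := a * (1 - (L ^ 2)⁻¹)

/-- `a_∞ > 0` for `a > 0`, `L > 1`. [cite: King1986, (2.13) p.653] -/
theorem aInf_pos {a L : ℝ} (ha : 0 < a) (hL : 1 < L) : 0 < aInf a L := by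
  unfold aInf
  have hL2 : 1 < L ^ 2 := by nlinarith
  have : (L ^ 2)⁻¹ < 1 := inv_lt_one_of_one_lt₀ hL2
  exact mul_pos ha (by linarith)

/-- `a_∞ ≤ a_k` (`k ≥ 1`) — the tree's `aK_ge`. [cite: King1986, (2.13) p.653] -/
theorem aInf_le_aK {a L : ℝ} (ha : 0 < a) (hL : 1 < L) {k : ℕ} (hk : 1 ≤ k) : aInf a L ≤ aK a L k := aK_ge ha hL hk

/-- `a_∞ ≤ a` (`a ≥ 0`, `L ≠ 0` irrelevant: `1 − L⁻² ≤ 1`). [cite: King1986, (2.13) p.653] -/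
theorem aInf_le {a L : ℝ} (ha : 0 ≤ a) : aInf a L ≤ a := by
  unfold aInf
  have : 0 ≤ (L ^ 2)⁻¹ := by positivity
  nlinarith

/-- ★ **`a_K → a_∞`** as `K → ∞` (`L > 1`): `L^{−2K} → 0`. [cite: King1986, (2.13) p.653] -/
theorem tendsto_aK {a L : ℝ} (hL : 1 < L) : Tendsto (fun K : ℕ => aK a L K) atTop (𝓝 (aInf a L)) := by
  have hL2 : 1 < L ^ 2 := by nlinarith
  have h1 : Tendsto (fun K : ℕ => (L ^ (2 * K))⁻¹) atTop (𝓝 0) := by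
    have h := tendsto_inv_atTop_zero.comp (tendsto_pow_atTop_atTop_of_one_lt hL2)
    refine h.congr fun K => ?_
    simp only [Function.comp_apply, pow_mul]
  have h2 : Tendsto (fun K : ℕ => 1 - (L ^ (2 * K))⁻¹) atTop (𝓝 (1 - 0)) := h1.const_sub 1
  rw [sub_zero] at h2
  have h3 : Tendsto (fun K : ℕ => a * (1 - (L ^ 2)⁻¹) / (1 - (L ^ (2 * K))⁻¹)) atTop (𝓝 (a * (1 - (L ^ 2)⁻¹) / 1)) :=
    tendsto_const_nhds.div h2 one_ne_zero
  rw [div_one] at h3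
  exact h3

/-- ★ `a_K⁻¹ → a_∞⁻¹` (`a > 0`, `L > 1`). [cite: King1986, (2.13) p.653] -/
theorem tendsto_inv_aK {a L : ℝ} (ha : 0 < a) (hL : 1 < L) : Tendsto (fun K : ℕ => (aK a L K)⁻¹) atTop (𝓝 ((aInf a L)⁻¹)) :=
  (tendsto_aK hL).inv₀ (aInf_pos ha hL).ne'

end Constants

/-! ## §3 The `K → ∞` limits of King's symbols on the torus -/

section Limits

variable (L : ℕ) (Mv : Fin d → ℕ) [hMv : ∀ μ, NeZero (Mv μ)]

/-- ★★★ **THE ALIAS SUM OF THE TORUS OPERATORS CONVERGES TO THE CONTINUUM ALIAS SERIES**: for `L` odd, `L ≥ 2`, `m² > 0`, every unit torus `Ω = Π ℤ∕M_μ` and every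
`q ∈ Ω̂`, `S_{L^K}(q) = Sfib (L^K) M (L^{2K}) m² q → S_∞(p′(q)) = Σ_{j ∈ ℤ^d} |u⁰(p′+2πj)|²∕(|p′+2πj|² + m²)` as `K → ∞`.
[cite: King1986, (4.5) p.670, (4.20)–(4.22) p.672] -/
theorem tendsto_Sfib_pow (hLodd : Odd L) (hL : 2 ≤ L) {m2 : ℝ} (hm : 0 < m2) (q : Tor Mv) :
    haveI : NeZero L := ⟨by omega⟩
    Tendsto (fun K : ℕ => Sfib (L ^ K) Mv (((L ^ K : ℕ) : ℝ) ^ 2) m2 q) atTop (𝓝 (aliasSeries0 m2 (sOf Mv q))) := by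
  haveI : NeZero L := ⟨by omega⟩
  have h := tendsto_aliasSumN_pow (d := d) hLodd hL hm (abs_sOf_le Mv q)
  refine h.congr fun K => ?_
  rw [Sfib_eq_aliasSumN (L ^ K) Mv hLodd.pow m2 q]

/-- ★★ **THE SYMBOL OF `(Δ^{(K)})⁻¹` CONVERGES**: `a_K⁻¹ + S_{L^K}(q) → a_∞⁻¹ + S_∞(p′(q))` (`L` odd `≥ 2`, `a, m² > 0`). [cite: King1986, (2.13)–(2.14) p.653, (4.5) p.670] -/
theorem tendsto_invSym_pow (hLodd : Odd L) (hL : 2 ≤ L) {a m2 : ℝ} (ha : 0 < a) (hm : 0 < m2) (q : Tor Mv) :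
    haveI : NeZero L := ⟨by omega⟩
    Tendsto (fun K : ℕ => (aK a L K)⁻¹ + Sfib (L ^ K) Mv (((L ^ K : ℕ) : ℝ) ^ 2) m2 q) atTop
      (𝓝 ((aInf a L)⁻¹ + aliasSeries0 m2 (sOf Mv q))) := by
  have hL1 : (1 : ℝ) < L := by exact_mod_cast (show 1 < L by omega)
  exact (tendsto_inv_aK ha hL1).add (tendsto_Sfib_pow L Mv hLodd hL hm q)

/-- KING's CONTINUUM SYMBOL `Δ^{(∞)}(p′) := a_∞∕(1 + a_∞·S_∞(p′))` — (4.5) at `η = 0`. [cite: King1986, (4.5) p.670] -/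
def effSymLim (a L m2 : ℝ) (p : Fin d → ℝ) : ℝ := aInf a L / (1 + aInf a L * aliasSeries0 m2 p)

omit hMv in
/-- `Δ^{(∞)}(p′) > 0` (`a > 0`, `L > 1`, `m² ≥ 0`). [cite: King1986, (4.5) p.670, (4.8) p.671] -/
theorem effSymLim_pos {a Lr m2 : ℝ} (ha : 0 < a) (hL : 1 < Lr) (hm : 0 ≤ m2) (p : Fin d → ℝ) : 0 < effSymLim a Lr m2 p := by
  unfold effSymLim
  have h1 := aInf_pos ha hL
  have h2 := aliasSeries0_nonneg (d := d) hm p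
  positivity

omit hMv in
/-- `Δ^{(∞)}(p′) = (a_∞⁻¹ + S_∞(p′))⁻¹`. [cite: King1986, (4.5) p.670] -/
theorem effSymLim_eq_inv {a Lr m2 : ℝ} (ha : 0 < a) (hL : 1 < Lr) (hm : 0 ≤ m2) (p : Fin d → ℝ) :
    effSymLim a Lr m2 p = ((aInf a Lr)⁻¹ + aliasSeries0 m2 p)⁻¹ := by
  unfold effSymLim
  have h1 := aInf_pos ha hL
  have h2 := aliasSeries0_nonneg (d := d) hm p
  field_simp

/-- ★★★ **THE EFFECTIVE LAPLACIAN's SYMBOL CONVERGES**: `effSym (L^K) M a_K L^{2K} m² q = a_K∕(1 + a_K S_{L^K}(q)) → Δ^{(∞)}(p′(q))` as `K → ∞` (`L` odd `≥ 2`,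
`a, m² > 0`, every unit torus and momentum). [cite: King1986, (2.13)–(2.14) p.653, (4.5) p.670] -/
theorem tendsto_effSym_pow (hLodd : Odd L) (hL : 2 ≤ L) {a m2 : ℝ} (ha : 0 < a) (hm : 0 < m2) (q : Tor Mv) :
    haveI : NeZero L := ⟨by omega⟩
    Tendsto (fun K : ℕ => effSym (L ^ K) Mv (aK a L K) (((L ^ K : ℕ) : ℝ) ^ 2) m2 q) atTop (𝓝 (effSymLim a L m2 (sOf Mv q))) := by
  haveI : NeZero L := ⟨by omega⟩
  have hL1 : (1 : ℝ) < L := by exact_mod_cast (show 1 < L by omega)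
  have hS := tendsto_Sfib_pow L Mv hLodd hL hm q
  have haK := tendsto_aK (a := a) hL1
  have hden : 1 + aInf a L * aliasSeries0 m2 (sOf Mv q) ≠ 0 := by
    have h1 := aInf_pos ha hL1
    have h2 := aliasSeries0_nonneg (d := d) hm.le (sOf Mv q)
    positivity
  unfold effSymLim
  have h := haK.div (tendsto_const_nhds.add (haK.mul hS)) hden
  refine h.congr fun K => ?_
  rfl

/-- ★★★ **KING's (4.5) AT `η = 0`**: `Δ^{(K)}(p′(q)) = DeltaEff a_K L^K m² p′(q) → Δ^{(∞)}(p′(q)) = (a_∞⁻¹ + Σ_{j ∈ ℤ^d} |u⁰(p′+2πj)|²∕(|p′+2πj|² + m²))⁻¹` as `K → ∞`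
(`L` odd `≥ 2`, `a, m² > 0`; `p′ = sOf q` any momentum of any unit torus). [cite: King1986, (2.13)–(2.14) p.653, (4.3)–(4.5) p.670] -/
theorem tendsto_DeltaEff_pow (hLodd : Odd L) (hL : 2 ≤ L) {a m2 : ℝ} (ha : 0 < a) (hm : 0 < m2) (q : Tor Mv) :
    Tendsto (fun K : ℕ => DeltaEff (aK a L K) (L ^ K) m2 (sOf Mv q)) atTop (𝓝 (effSymLim a L m2 (sOf Mv q))) := by
  haveI : NeZero L := ⟨by omega⟩
  have hL1 : (1 : ℝ) < L := by exact_mod_cast (show 1 < L by omega)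
  refine (tendsto_effSym_pow L Mv hLodd hL ha hm q).congr' ?_
  filter_upwards [eventually_ge_atTop 1] with K hK
  have hN1 : 1 ≤ L ^ K := Nat.one_le_pow _ _ (by omega)
  have haK : 0 < aK a (L : ℝ) K := aK_pos ha hL1 hK
  rw [← effSym_eq_DeltaEff (L ^ K) Mv hN1 haK hm q, Nat.cast_pow]

end Limits

end Summit.QuantumFields.YangMills.BalabanUVNodes.N15KingModelRung

end
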